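import Literature.Probability.RandomPlanarGeometry.HexSAWStripBridgeLengthLinear
import HarnessLib

/-!
# The renewal equation of the critical strip bridges in the LENGTH variable is exact: `U_σ = M_σ + Σ_{τ<σ} M_τ U_{σ−τ}`, and the
# LENGTH renewal pair (module «BRIDGE-LENGTH-RENEWAL»)

Topic `Literature/Probability/RandomPlanarGeometry` (continues «LENGTH-POINTWISE» `HexSAWStripBridgeLengthPointwise.lean` — the length
slices `HV.LUset` / `HV.LMset` (standard horizontal bridges / irreducible ones with exactly `σ` steps), their weights `HV.LUs` / `HV.LMs`,
the level matrices `HV.LUM` / `HV.LMM`, and the split INEQUALITY `HV.LUM_le_split` at the first renewal point —, `HexSAWStripBridgeRenewal.lean`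
(`HV.hcat`, `HV.hcat_spec`: gluing an irreducible bridge and a bridge; `HV.fstP`, `HV.sndP`, `HV.wD_eq_mul_fstP_sndP`), and
«BRIDGE-LENGTH-LINEAR» `HexSAWStripBridgeLengthLinear.lean` (the two-sided linear law `Σ_{a,b} D_N(a,b)(y_T) ≍ N`).  Tool interface:
the tree's `Literature.Probability.Process.RenewalKernelPair` (`Process/MatrixRenewalCoefficients.lean`).  Lane «pcv-sawmu»
(CriticalPhenomena venture), a-p2 g21.  Sources of the SETTING: H. Duminil-Copin, A. Hammond, CMP 324 (2013) §2.2 (bridges, renewal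
points, irreducible bridges, unique decomposition; Kesten 1963); W. Feller, vol. I (1968) XIII.3 (the renewal equation); N. R. Beaton,
M. Bousquet-Mélou, J. de Gier, H. Duminil-Copin, A. J. Guttmann, CMP 326 (2014) Corollary 8 (`y_T`).  Nothing of the kind is printed
for the strip.

## What is proved (namespace `Literature.Probability.RandomPlanarGeometry.SAW.HV`)

* §1 `of_mem_LMset`, `of_mem_LUset` (plumbing); ★ `hcat_mem_LUset` — gluing `p ∈ LMset T N τ a c` and `q ∈ LUset T N τ' c b`
  (`τ + τ' ≤ N`) gives a bridge of `LUset T N (τ+τ') a b` with a renewal index whose split returns `p` and the translate of `q`,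
  weights multiplying; ★★ `split_le_LUM` — the REVERSED split inequality `M_σ + Σ_{τ ∈ [1,σ)} M_τ U_{σ−τ} ≤ U_σ` (`σ ≤ N`);
  ★★★ `LUM_eq_split` — with the tree's `LUM_le_split`, EQUALITY: `U_σ(a,b) = M_σ(a,b) + Σ_{τ ∈ [1,σ)} Σ_c M_τ(a,c) U_{σ−τ}(c,b)`
  for `σ ≤ N`, `y ≥ 0` — the renewal equation of the strip bridges in the length variable, exact.
* §2 `LUset_eq_of_le`, `LMset_eq_of_le`, `LUM_LMM_eq_of_le` (the slices do not depend on the truncation `N ≥ σ`), `LMM_eq_zero_of_le`.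
* §3 ★★ `LUM_ren` — with `M(n) := LMM T n n y`, `D(n) := LUM T n n y`: the exact matrix renewal equation
  `D(n) = M(n) + Σ_{i+j=n} M(i) D(j)` (every `y ≥ 0`, every `T`) — the `ren` field of a `RenewalKernelPair (Fin (2T))` for these data
  (the structure value is left to the user); `LMM_le_LUM_self`.
* §4 `summable_LUM_LMM_mul_pow` (at `y_T`: `D(n)_{ab} ≤ K`, so `Σ_n D(n)_{ab} s^n`, `Σ_n M(n)_{ab} s^n` converge on `[0,1)`);
  ★★ `partialSum_LUM_linear` — `c · N − C ≤ Σ_{n ∈ [1,N]} Σ_{a,b} D(n)_{ab} ≤ K · N` at `y_T` (`T ≥ 2`; «BRIDGE-LENGTH-LINEAR» transported).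

Purpose: the combinatorial input of the lane's LENGTH programme (HANDOFF a-p2 g19 (B)) — with «BRIDGE-LENGTH-LINEAR» (two-sided
first-order bounds) the remaining analytic inputs for the tree's matrix renewal theorem at `y = y_T` are the Abelian limit
`(1 − s) Σ_n D(n)_{ab} s^n → L_{ab}` (a residue theorem in the length fugacity `s`, via `NonnegMatrixFamilyResidue`) and the finite mean
length of irreducible bridges; lengths between fixed levels have fixed parity, so the pointwise law needs the period-two variant.
Label: LANE THEOREM (own; the exactness is the lane's, the objects are the tree's).  NOT claimed: any limit (the Abelian / Cesàro laws in
length are the sequel).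
-/

noncomputable section

open Finset Filter Topology Matrix Literature.Probability.LatticeModels Literature.Probability.Percolation

namespace Literature.Probability.RandomPlanarGeometry.SAW

namespace HV

/-! ### §1 Gluing an irreducible bridge and a bridge: the split inequality REVERSED -/

section Glue

variable {T N : ℕ} {y : ℝ} {σ : ℤ}

/-- Data of a member of `LMset` (plumbing). [cite: DuminilCopinHammond2013, §2.2; lane plumbing] -/
theorem of_mem_LMset {τ : ℤ} {a c : ℤ} {p : List HV} (hp : p ∈ LMset T N τ a c) :
    p.IsChain hvGraph.Adj ∧ p.Nodup ∧ p.length ≤ N + 1 ∧ (∀ hne : p ≠ [], (p.head hne).1 = 0) ∧ InLev T p ∧ IsHBridge p ∧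
      renIdxs p = ∅ ∧ 2 ≤ p.length ∧ hdLev p = a ∧ ltLev p = c ∧ hlen p = τ := by
  rw [LMset, mem_filter, HBk, mem_filter, mem_hBridgesN_iff] at hp
  obtain ⟨⟨⟨hc, hnd, hlenN, ⟨v, hv, hv0⟩, hin, hB⟩, h2, hnp, ha, hb⟩, hsz⟩ := hp
  refine ⟨hc, hnd, hlenN, fun hne => ?_, hin, hB, ?_, h2, ha, hb, hsz⟩
  · rw [List.head?_eq_some_head hne, Option.some_inj] at hv
    rw [hv]; exact hv0
  · rw [npieces] at hnp
    exact Finset.card_eq_zero.1 (by omega)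

/-- Data of a member of `LUset` (plumbing). [cite: DuminilCopinHammond2013, §2.2; lane plumbing] -/
theorem of_mem_LUset {τ : ℤ} {c b : ℤ} {q : List HV} (hq : q ∈ LUset T N τ c b) :
    q.IsChain hvGraph.Adj ∧ q.Nodup ∧ q.length ≤ N + 1 ∧ (∀ hne : q ≠ [], (q.head hne).1 = 0) ∧ InLev T q ∧ IsHBridge q ∧
      2 ≤ q.length ∧ hdLev q = c ∧ ltLev q = b ∧ hlen q = τ := by
  rw [LUset, mem_filter, HBab, mem_filter, mem_hBridgesN_iff] at hq
  obtain ⟨⟨⟨hc, hnd, hlenN, ⟨v, hv, hv0⟩, hin, hB⟩, h2, ha, hb⟩, hsz⟩ := hq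
  refine ⟨hc, hnd, hlenN, fun hne => ?_, hin, hB, h2, ha, hb, hsz⟩
  rw [List.head?_eq_some_head hne, Option.some_inj] at hv
  rw [hv]; exact hv0

/-- ★ **Gluing lands in the length slice**: for `p ∈ LMset T N τ a c` (irreducible, `τ` steps) and `q ∈ LUset T N τ' c b` with
`τ + τ' ≤ N`, the concatenation `hcat p q` is a standard bridge `a → b` with `τ + τ'` steps, a renewal index, first piece `p` and
remainder the translate of `q`; its weight is the product. [cite: DuminilCopinHammond2013, §2.2 (concatenation of bridges); lane «pcv-sawmu» a-p2 g21] -/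
theorem hcat_mem_LUset {τ τ' : ℤ} {a c b : ℤ} {p q : List HV} (hp : p ∈ LMset T N τ a c) (hq : q ∈ LUset T N τ' c b)
    (hN : τ + τ' ≤ N) :
    hcat p q ∈ LUset T N (τ + τ') a b ∧ (renIdxs (hcat p q)).Nonempty ∧ fstP (hcat p q) = p ∧
      sndP (hcat p q) = q.map (shift (p.getLast?.getD hvOrigin).1 0) ∧ wD T y (hcat p q) = wD T y p * wD T y q := by
  obtain ⟨hpc, hpn, -, hp0, hpin, hpB, hpirr, hp2, hpa, hpc', hpτ⟩ := of_mem_LMset hp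
  obtain ⟨hqc, hqn, -, hq0, hqin, hqB, hq2, hqa, hqb, hqτ⟩ := of_mem_LUset hq
  have hpne : p ≠ [] := List.ne_nil_of_length_pos (by omega)
  have hqne : q ≠ [] := List.ne_nil_of_length_pos (by omega)
  have hlev : ∀ (hp' : p ≠ []) (hq' : q ≠ []), lev (p.getLast hp') = lev (q.head hq') :=
    fun hp' hq' => lev_getLast_eq_lev_head_of hpc' hqa hp' hq'
  obtain ⟨hc, hnd, hin, hB, hlenc, hhead, hren, -, hfst, hsnd⟩ :=
    hcat_spec hpc hpn hpin hpB hpirr hp2 hqc hqn hqin hqB hq2 hq0 hlev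
  have hτlen : (p.length : ℤ) = τ + 1 ∧ (q.length : ℤ) = τ' + 1 := by
    unfold HV.hlen at hpτ hqτ; constructor <;> omega
  refine ⟨?_, hren, hfst, hsnd, ?_⟩
  · rw [LUset, mem_filter, HBab, mem_filter, mem_hBridgesN_iff]
    refine ⟨⟨⟨hc, hnd, by rw [hlenc]; omega, ?_, hin, hB⟩, by rw [hlenc]; omega, ?_, ?_⟩, ?_⟩
    · obtain ⟨v, t, rfl⟩ := List.exists_cons_of_ne_nil hpne
      exact ⟨v, by rw [hhead]; rfl, hp0 hpne⟩
    · rw [hdLev, hhead]; exact hpa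
    · -- the last vertex is the translate of the last vertex of `q`
      obtain ⟨u0, u1, urest, rfl⟩ : ∃ u0 u1 urest, q = u0 :: u1 :: urest := by
        match q, hq2 with
        | u0 :: u1 :: urest, _ => exact ⟨u0, u1, urest, rfl⟩
      have hm : ((u1 :: urest).map (shift (p.getLast?.getD hvOrigin).1 0)) ≠ [] := by simp
      rw [ltLev, hcat, List.tail_cons, List.getLast?_append, List.getLast?_map]
      rw [ltLev, List.getLast?_cons_cons] at hqb
      cases h : (u1 :: urest).getLast? with
      | none => simp at h
      | some w =>
        rw [h] at hqb
        simp only [Option.map_some, Option.some_or, Option.getD_some, lev_shift_zero]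
        simpa using hqb
    · unfold HV.hlen; rw [hlenc]; omega
  · rw [wD_eq_mul_fstP_sndP T y hren, hfst, hsnd, wD_map_shift]

/-- ★★ **The reversed split inequality**: for `1 ≤ σ ≤ N`,
`M_σ(a,b) + Σ_{τ ∈ [1,σ)} Σ_c M_τ(a,c) U_{σ−τ}(c,b) ≤ U_σ(a,b)` — gluing is injective into the bridges with `σ` steps
(the irreducible ones apart). With the tree's `LUM_le_split` this is an EQUALITY (`LUM_eq_split`).
[cite: DuminilCopinHammond2013, §2.2 (unique decomposition at the first renewal point); lane «pcv-sawmu» a-p2 g21 — own] -/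
theorem split_le_LUM (hy : 0 ≤ y) (hσN : σ ≤ N) (a b : Fin (2 * T)) :
    LMM T N σ y a b + (∑ τ ∈ Finset.Ico (1 : ℤ) σ, LMM T N τ y * LUM T N (σ - τ) y) a b ≤ LUM T N σ y a b := by
  classical
  set S := LUset T N σ (a : ℕ) (b : ℕ) with hS
  set Sirr := S.filter fun l => renIdxs l = ∅ with hSirr
  set Sred := S.filter fun l => renIdxs l ≠ ∅ with hSred
  -- (1) the irreducible part: `LMset ⊆ Sirr`
  have hirr : LMM T N σ y a b ≤ ∑ l ∈ Sirr, wD T y l := by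
    rw [LMM, LMs]
    refine sum_le_sum_of_subset_of_nonneg (fun l hl => ?_) fun _ _ _ => wD_nonneg T hy _
    have hl' := hl
    rw [LMset, mem_filter, HBk, mem_filter] at hl
    obtain ⟨⟨hb, h2, hnp, ha, hb'⟩, hsz⟩ := hl
    obtain ⟨-, -, -, -, -, -, hren, -⟩ := of_mem_LMset hl'
    rw [hSirr, mem_filter, hS, LUset, mem_filter, HBab, mem_filter]
    exact ⟨⟨⟨hb, h2, ha, hb'⟩, hsz⟩, hren⟩
  -- (2) the reducible part: glue the pairs of the double union
  set tgt : Finset (List HV × List HV) := (Finset.univ : Finset (Fin (2 * T))).biUnion fun c =>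
    (Finset.Ico (1 : ℤ) σ).biUnion fun τ => LMset T N τ (a : ℕ) (c : ℕ) ×ˢ LUset T N (σ - τ) (c : ℕ) (b : ℕ) with htgt
  have hmem_tgt : ∀ pq ∈ tgt, ∃ (c : Fin (2 * T)) (τ : ℤ), τ ∈ Finset.Ico (1 : ℤ) σ ∧
      pq.1 ∈ LMset T N τ (a : ℕ) (c : ℕ) ∧ pq.2 ∈ LUset T N (σ - τ) (c : ℕ) (b : ℕ) := by
    intro pq hpq
    rw [htgt, mem_biUnion] at hpq
    obtain ⟨c, -, hpq⟩ := hpq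
    rw [mem_biUnion] at hpq
    obtain ⟨τ, hτ, hpq⟩ := hpq
    rw [mem_product] at hpq
    exact ⟨c, τ, hτ, hpq.1, hpq.2⟩
  have hglue : ∀ pq ∈ tgt, hcat pq.1 pq.2 ∈ Sred ∧ fstP (hcat pq.1 pq.2) = pq.1 ∧
      sndP (hcat pq.1 pq.2) = pq.2.map (shift (pq.1.getLast?.getD hvOrigin).1 0) ∧
      wD T y (hcat pq.1 pq.2) = wD T y pq.1 * wD T y pq.2 := by
    intro pq hpq
    obtain ⟨c, τ, hτ, h1, h2⟩ := hmem_tgt pq hpq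
    obtain ⟨hmem, hren, hfst, hsnd, hw⟩ := hcat_mem_LUset (y := y) h1 h2 (by rw [Finset.mem_Ico] at hτ; omega)
    refine ⟨?_, hfst, hsnd, hw⟩
    rw [hSred, mem_filter, hS]
    rw [show τ + (σ - τ) = σ by ring] at hmem
    exact ⟨hmem, Finset.nonempty_iff_ne_empty.1 hren⟩
  have hinj : Set.InjOn (fun pq : List HV × List HV => hcat pq.1 pq.2) (tgt : Set (List HV × List HV)) := by
    rintro ⟨p, q⟩ hpq ⟨p', q'⟩ hpq' heq
    obtain ⟨-, hf, hs, -⟩ := hglue _ hpq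
    obtain ⟨-, hf', hs', -⟩ := hglue _ hpq'
    simp only at heq hf hs hf' hs'
    have hp : p = p' := by rw [← hf, ← hf', heq]
    subst hp
    have hq : q.map (shift (p.getLast?.getD hvOrigin).1 0) = q'.map (shift (p.getLast?.getD hvOrigin).1 0) := by
      rw [← hs, ← hs', heq]
    exact Prod.ext rfl ((List.map_injective_iff.2 (shift _ 0).injective) hq)
  -- the sum over `tgt` of the product weights is the matrix product (the bookkeeping of `LUM_le_split`)
  have htgt_sum : ∑ pq ∈ tgt, wD T y pq.1 * wD T y pq.2 = (∑ τ ∈ Finset.Ico (1 : ℤ) σ, LMM T N τ y * LUM T N (σ - τ) y) a b := by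
    rw [Matrix.sum_apply, htgt, sum_biUnion]
    · have inner : ∀ c : Fin (2 * T), ∑ pq ∈ (Finset.Ico (1 : ℤ) σ).biUnion (fun τ =>
          LMset T N τ (a : ℕ) (c : ℕ) ×ˢ LUset T N (σ - τ) (c : ℕ) (b : ℕ)), wD T y pq.1 * wD T y pq.2 =
          ∑ τ ∈ Finset.Ico (1 : ℤ) σ, LMs T N τ (a : ℕ) (c : ℕ) y * LUs T N (σ - τ) (c : ℕ) (b : ℕ) y := by
        intro c
        rw [sum_biUnion]
        · refine sum_congr rfl fun τ _ => ?_
          rw [sum_product, LMs, LUs, sum_mul_sum]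
        · intro i _ i' _ hne
          rw [Function.onFun, disjoint_left]
          intro pq h1 h2
          rw [mem_product, LMset, mem_filter] at h1 h2
          exact hne (h1.1.2.symm.trans h2.1.2)
      simp_rw [inner]
      rw [sum_comm]
      refine sum_congr rfl fun τ _ => ?_
      rw [Matrix.mul_apply]; rfl
    · intro c _ c' _ hcc'
      rw [Function.onFun, disjoint_left]
      intro pq h1 h2
      rw [mem_biUnion] at h1 h2
      obtain ⟨i, -, h1⟩ := h1
      obtain ⟨i', -, h2⟩ := h2
      rw [mem_product, LMset, mem_filter, HBk, mem_filter] at h1 h2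
      have e1 := h1.1.1.2.2.2.2; have e2 := h2.1.1.2.2.2.2
      exact hcc' (Fin.ext (by have := e1.symm.trans e2; exact_mod_cast this))
  have hred : (∑ τ ∈ Finset.Ico (1 : ℤ) σ, LMM T N τ y * LUM T N (σ - τ) y) a b ≤ ∑ l ∈ Sred, wD T y l := by
    rw [← htgt_sum]
    calc ∑ pq ∈ tgt, wD T y pq.1 * wD T y pq.2 = ∑ pq ∈ tgt, wD T y (hcat pq.1 pq.2) :=
          sum_congr rfl fun pq hpq => (hglue pq hpq).2.2.2.symm
      _ = ∑ l ∈ tgt.image (fun pq => hcat pq.1 pq.2), wD T y l := by rw [sum_image hinj]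
      _ ≤ ∑ l ∈ Sred, wD T y l := by
          refine sum_le_sum_of_subset_of_nonneg (fun l hl => ?_) fun _ _ _ => wD_nonneg T hy _
          rw [mem_image] at hl
          obtain ⟨pq, hpq, rfl⟩ := hl
          exact (hglue pq hpq).1
  have hsplitS : ∑ l ∈ S, wD T y l = ∑ l ∈ Sirr, wD T y l + ∑ l ∈ Sred, wD T y l := by
    rw [hSirr, hSred, ← sum_filter_add_sum_filter_not S (fun l => renIdxs l = ∅)]
  calc LMM T N σ y a b + (∑ τ ∈ Finset.Ico (1 : ℤ) σ, LMM T N τ y * LUM T N (σ - τ) y) a b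
      ≤ ∑ l ∈ Sirr, wD T y l + ∑ l ∈ Sred, wD T y l := add_le_add hirr hred
    _ = LUM T N σ y a b := by rw [← hsplitS]; rfl

/-- ★★★ **THE FIRST-RENEWAL SPLIT IN LENGTH IS EXACT**: for `σ ≤ N` and `y ≥ 0`,
`U_σ(a,b) = M_σ(a,b) + Σ_{τ ∈ [1,σ)} Σ_c M_τ(a,c) · U_{σ−τ}(c,b)` — every standard horizontal bridge of `S_T` with `σ` steps is
irreducible or splits uniquely at its first renewal vertex into an irreducible bridge with `τ` steps and a bridge with `σ − τ` steps,
levels matching and weights multiplying (the RENEWAL EQUATION of the critical strip bridges in the LENGTH variable).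
[cite: DuminilCopinHammond2013, §2.2 (unique decomposition into irreducible bridges); Feller1968, XIII.3 (renewal equation); lane «pcv-sawmu» a-p2 g21 — own] -/
theorem LUM_eq_split (hy : 0 ≤ y) (hσN : σ ≤ N) (a b : Fin (2 * T)) :
    LUM T N σ y a b = LMM T N σ y a b + (∑ τ ∈ Finset.Ico (1 : ℤ) σ, LMM T N τ y * LUM T N (σ - τ) y) a b :=
  le_antisymm (LUM_le_split hy σ a b) (split_le_LUM hy hσN a b)

end Glue

/-! ### §2 The length slices do not depend on the truncation -/

section Trunc

variable {T N N' : ℕ} {y : ℝ} {σ : ℤ}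

/-- A bridge with `σ` steps has `σ + 1` vertices: the slice `LUset T N σ` is the same for every truncation `N ≥ σ` (plumbing).
[cite: DuminilCopinHammond2013, §2.2; lane plumbing] -/
theorem LUset_eq_of_le (hσ : σ ≤ N) (hσ' : σ ≤ N') (a b : ℤ) : LUset T N σ a b = LUset T N' σ a b := by
  ext l
  simp only [LUset, mem_filter, HBab, mem_hBridgesN_iff]
  constructor
  · rintro ⟨⟨⟨hc, hnd, -, hh, hin, hB⟩, h2, ha, hb⟩, hsz⟩
    exact ⟨⟨⟨hc, hnd, by unfold hlen at hsz; omega, hh, hin, hB⟩, h2, ha, hb⟩, hsz⟩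
  · rintro ⟨⟨⟨hc, hnd, -, hh, hin, hB⟩, h2, ha, hb⟩, hsz⟩
    exact ⟨⟨⟨hc, hnd, by unfold hlen at hsz; omega, hh, hin, hB⟩, h2, ha, hb⟩, hsz⟩

/-- The same for the irreducible slices (plumbing). [cite: DuminilCopinHammond2013, §2.2; lane plumbing] -/
theorem LMset_eq_of_le (hσ : σ ≤ N) (hσ' : σ ≤ N') (a b : ℤ) : LMset T N σ a b = LMset T N' σ a b := by
  ext l
  simp only [LMset, mem_filter, HBk, mem_hBridgesN_iff]
  constructor
  · rintro ⟨⟨⟨hc, hnd, -, hh, hin, hB⟩, h2, hnp, ha, hb⟩, hsz⟩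
    exact ⟨⟨⟨hc, hnd, by unfold hlen at hsz; omega, hh, hin, hB⟩, h2, hnp, ha, hb⟩, hsz⟩
  · rintro ⟨⟨⟨hc, hnd, -, hh, hin, hB⟩, h2, hnp, ha, hb⟩, hsz⟩
    exact ⟨⟨⟨hc, hnd, by unfold hlen at hsz; omega, hh, hin, hB⟩, h2, hnp, ha, hb⟩, hsz⟩

/-- `LUM T N σ = LUM T N' σ` and `LMM T N σ = LMM T N' σ` for `σ ≤ N, N'`. [cite: DuminilCopinHammond2013, §2.2; lane plumbing] -/
theorem LUM_LMM_eq_of_le (hσ : σ ≤ N) (hσ' : σ ≤ N') (y : ℝ) :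
    LUM T N σ y = LUM T N' σ y ∧ LMM T N σ y = LMM T N' σ y := by
  constructor
  · ext a b; simp only [LUM, LUs]; rw [LUset_eq_of_le hσ hσ' _ _]
  · ext a b; simp only [LMM, LMs]; rw [LMset_eq_of_le hσ hσ' _ _]

/-- No irreducible bridge (with at least two vertices) has `≤ 0` steps: `LMM T N σ = 0` for `σ ≤ 0` (plumbing). [cite: DuminilCopinHammond2013, §2.2; lane plumbing] -/
theorem LMM_eq_zero_of_le (hσ : σ ≤ 0) (y : ℝ) (a b : Fin (2 * T)) : LMM T N σ y a b = 0 := by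
  rw [LMM, LMs]
  refine sum_eq_zero fun l hl => ?_
  exfalso
  obtain ⟨-, -, -, -, -, hB, -, h2, -, -, hsz⟩ := of_mem_LMset hl
  have := one_le_hlen_of_two_le hB h2
  omega

end Trunc

/-! ### §3 The matrix renewal equation of the critical strip bridges in the LENGTH variable, `ℕ`-indexed -/

section Pair

variable {T : ℕ}

/-- ★★ **THE LENGTH RENEWAL EQUATION, in the format of the tree's `RenewalKernelPair`**: with `M(n) := LMM T n n y` (irreducible
standard bridges with `n` steps) and `D(n) := LUM T n n y` (all standard bridges with `n` steps; `M(0) = D(0) = 0`), for every `n` and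
`y ≥ 0`: `D(n) = M(n) + Σ_{i+j=n} M(i) · D(j)` (matrix product over the `2T` levels).  So `⟨M, D⟩` is a `RenewalKernelPair (Fin (2T))`
(the structure value is left to the user: `M_nonneg`/`D_nonneg` are `LMM_LUM_nonneg`, `ren` is this theorem).
[cite: DuminilCopinHammond2013, §2.2; Feller1968, XIII.3 (renewal equation); lane «pcv-sawmu» a-p2 g21 — own] -/
theorem LUM_ren {y : ℝ} (hy : 0 ≤ y) (n : ℕ) :
    LUM T n (n : ℤ) y = LMM T n (n : ℤ) y + ∑ p ∈ antidiagonal n, LMM T p.1 (p.1 : ℤ) y * LUM T p.2 (p.2 : ℤ) y := by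
  classical
  ext a b
  rw [Matrix.add_apply, LUM_eq_split hy le_rfl a b]
  congr 1
  -- `Σ_{τ ∈ [1, n)} M_τ U_{n−τ}` (truncation `n`) versus `Σ_{i+j=n} M(i) D(j)` (truncations `i`, `j`; the terms `i = 0`, `j = 0` vanish)
  rw [Matrix.sum_apply, Matrix.sum_apply]
  have hvan : ∀ p ∈ antidiagonal n, ¬ (1 ≤ p.1 ∧ 1 ≤ p.2) →
      (LMM T p.1 (p.1 : ℤ) y * LUM T p.2 (p.2 : ℤ) y) a b = 0 := by
    intro p hp h
    rw [Matrix.mul_apply]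
    refine sum_eq_zero fun c _ => ?_
    rcases Nat.eq_zero_or_pos p.1 with h1 | h1
    · rw [h1, Nat.cast_zero, LMM_eq_zero_of_le le_rfl, zero_mul]
    · have h2 : p.2 = 0 := by omega
      rw [h2, Nat.cast_zero, LUM_eq_zero_of_le le_rfl, mul_zero]
  rw [← sum_filter_of_ne (s := antidiagonal n) (p := fun p => 1 ≤ p.1 ∧ 1 ≤ p.2) (fun p hp hne => by
    by_contra h; exact hne (hvan p hp h))]
  refine (sum_nbij' (fun p : ℕ × ℕ => (p.1 : ℤ)) (fun τ : ℤ => (τ.toNat, n - τ.toNat)) (fun p hp => ?_) (fun τ hτ => ?_)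
    (fun p hp => ?_) (fun τ hτ => ?_) (fun p hp => ?_)).symm
  · rw [mem_filter, HasAntidiagonal.mem_antidiagonal] at hp
    rw [Finset.mem_Ico]; omega
  · rw [Finset.mem_Ico] at hτ
    rw [mem_filter, HasAntidiagonal.mem_antidiagonal]
    simp only
    omega
  · rw [mem_filter, HasAntidiagonal.mem_antidiagonal] at hp
    obtain ⟨i, j⟩ := p
    simp only at hp ⊢
    ext
    · simp
    · simp; omega
  · rw [Finset.mem_Ico] at hτ
    simp only
    omega
  · rw [mem_filter, HasAntidiagonal.mem_antidiagonal] at hp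
    obtain ⟨hp1, hp2⟩ := hp
    have hi : (p.1 : ℤ) ≤ n := by omega
    have hj : ((n : ℤ) - p.1) = (p.2 : ℤ) := by omega
    rw [(LUM_LMM_eq_of_le (T := T) (le_refl (p.1 : ℤ)) hi y).2, hj,
      (LUM_LMM_eq_of_le (T := T) (le_refl (p.2 : ℤ)) (show (p.2 : ℤ) ≤ n by omega) y).1]

/-- `M(n) ≤ D(n)` entrywise (an irreducible bridge is a bridge; from `LUM_ren` and non-negativity). [cite: DuminilCopinHammond2013, §2.2; lane plumbing] -/
theorem LMM_le_LUM_self {y : ℝ} (hy : 0 ≤ y) (n : ℕ) (a b : Fin (2 * T)) :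
    LMM T n (n : ℤ) y a b ≤ LUM T n (n : ℤ) y a b := by
  rw [LUM_ren hy n, Matrix.add_apply, Matrix.sum_apply]
  have : 0 ≤ ∑ p ∈ antidiagonal n, (LMM T p.1 (p.1 : ℤ) y * LUM T p.2 (p.2 : ℤ) y) a b :=
    sum_nonneg fun p _ => by
      rw [Matrix.mul_apply]
      exact sum_nonneg fun c _ => mul_nonneg (LMM_LUM_nonneg hy _ _ _).1 (LMM_LUM_nonneg hy _ _ _).2
  linarith

end Pair

/-! ### §4 At the threshold: the length slices are bounded, their series converge on `[0,1)`, and the cumulative sum is of order `N` -/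

section Threshold

variable {T : ℕ}

/-- At `y = y_T` the slices `D(n)_{ab} = LUM T n n y_T a b` are bounded uniformly in `n` (the length-pointwise law), hence
`Σ_n D(n)_{ab} s^n` converges for `0 ≤ s < 1` (the `summable` field of `RenewalKernelPair.Critical` for the length pair), and so does
the irreducible series `Σ_n M(n)_{ab} s^n`. [cite: DuminilCopinHammond2013, §2.2; BeatonBousquetMelouDeGierDuminilCopinGuttmann2014, Corollary 8 (arXiv v5 p. 12); lane «pcv-sawmu» a-p2 g17/g21] -/
theorem summable_LUM_LMM_mul_pow (hT : 1 ≤ T) (a b : Fin (2 * T)) {s : ℝ} (hs0 : 0 ≤ s) (hs1 : s < 1) :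
    (∃ K : ℝ, ∀ n : ℕ, LUM T n (n : ℤ) (stripYT T) a b ≤ K) ∧
      Summable (fun n : ℕ => LUM T n (n : ℤ) (stripYT T) a b * s ^ n) ∧
      Summable (fun n : ℕ => LMM T n (n : ℤ) (stripYT T) a b * s ^ n) := by
  obtain ⟨K, hK⟩ := exists_LUs_stripYT_le hT
  have hy := (stripYT_pos hT).le
  have hD : ∀ n : ℕ, 0 ≤ LUM T n (n : ℤ) (stripYT T) a b ∧ LUM T n (n : ℤ) (stripYT T) a b ≤ K := fun n =>
    ⟨(LMM_LUM_nonneg hy _ a b).2, by rw [LUM]; exact hK n _ a b⟩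
  have hsD : Summable (fun n : ℕ => LUM T n (n : ℤ) (stripYT T) a b * s ^ n) := by
    refine Summable.of_nonneg_of_le (fun n => mul_nonneg (hD n).1 (pow_nonneg hs0 _))
      (fun n => mul_le_mul_of_nonneg_right (hD n).2 (pow_nonneg hs0 _)) ?_
    exact (summable_geometric_of_lt_one hs0 hs1).mul_left K
  refine ⟨⟨K, fun n => (hD n).2⟩, hsD, ?_⟩
  exact hsD.of_nonneg_of_le (fun n => mul_nonneg (LMM_LUM_nonneg hy _ a b).1 (pow_nonneg hs0 _))
    fun n => mul_le_mul_of_nonneg_right (LMM_le_LUM_self hy n a b) (pow_nonneg hs0 _)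

/-- ★★ **The cumulative length law, `ℕ`-indexed**: at `y = y_T`, `Σ_{n ∈ [1,N]} Σ_{a,b} D(n)_{ab} = Σ_{a,b} D_N(a,b)(y_T)` (`Dab_eq_sum_LUs` and
truncation independence), so by «BRIDGE-LENGTH-LINEAR» there are `c > 0`, `C`, `K` with
`c · N − C ≤ Σ_{n ∈ [1,N]} Σ_{a,b} LUM T n n y_T a b ≤ K · N` for all `N` (`T ≥ 2`).
[cite: DuminilCopinHammond2013, §2.2; BeatonBousquetMelouDeGierDuminilCopinGuttmann2014, Corollary 8; lane «pcv-sawmu» a-p2 g21 — own] -/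
theorem partialSum_LUM_linear (hT : 2 ≤ T) :
    ∃ c : ℝ, 0 < c ∧ ∃ C K : ℝ, ∀ N : ℕ,
      c * N - C ≤ ∑ n ∈ Finset.Icc 1 N, ∑ a : Fin (2 * T), ∑ b : Fin (2 * T), LUM T n (n : ℤ) (stripYT T) a b ∧
      ∑ n ∈ Finset.Icc 1 N, ∑ a : Fin (2 * T), ∑ b : Fin (2 * T), LUM T n (n : ℤ) (stripYT T) a b ≤ K * N := by
  have hT1 : 1 ≤ T := by omega
  obtain ⟨c, hc, C, hlow⟩ := exists_linear_le_sum_Dab_stripYT hT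
  obtain ⟨K, -, hup⟩ := exists_sum_Dab_stripYT_le_linear hT1
  -- the partial sums ARE the box sums `Σ_{a,b} D_N(a,b)(y_T)`
  have hkey : ∀ N : ℕ, ∑ n ∈ Finset.Icc 1 N, ∑ a : Fin (2 * T), ∑ b : Fin (2 * T), LUM T n (n : ℤ) (stripYT T) a b =
      ∑ a : Fin (2 * T), ∑ b : Fin (2 * T), Dab T N (a : ℕ) (b : ℕ) (stripYT T) := by
    intro N
    rw [sum_comm]
    refine sum_congr rfl fun a _ => ?_
    rw [sum_comm]
    refine sum_congr rfl fun b _ => ?_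
    rw [Dab_eq_sum_LUs]
    refine sum_nbij' (fun n : ℕ => (n : ℤ)) (fun σ : ℤ => σ.toNat) (fun n hn => ?_) (fun σ hσ => ?_) (fun n hn => by simp)
      (fun σ hσ => ?_) (fun n hn => ?_)
    · rw [Finset.mem_Icc] at hn ⊢; omega
    · rw [Finset.mem_Icc] at hσ ⊢; omega
    · rw [Finset.mem_Icc] at hσ; omega
    · rw [Finset.mem_Icc] at hn
      rw [LUM, LUs, LUs, LUset_eq_of_le (le_refl (n : ℤ)) (show (n : ℤ) ≤ N by omega)]
  refine ⟨c, hc, C, K, fun N => ⟨?_, ?_⟩⟩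
  · rw [hkey]; exact hlow N
  · rw [hkey]; exact hup N

end Threshold

end HV

end Literature.Probability.RandomPlanarGeometry.SAW
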